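import Literature.AlgebraicGeometry.HodgeTheory.HodgeConjectureProductsOddHypersurfacesSupportedMiddle
import Literature.AlgebraicGeometry.HodgeTheory.SupportedClassesOfSmallChowGroups
import Literature.AlgebraicGeometry.Motives.CompleteIntersectionChowGroups
import Literature.AlgebraicGeometry.Motives.NonsingularFormIrreducible
import HarnessLib

/-!
# `HC(Y × Y')` for two smooth CUBIC FIVEFOLDS in `ℙ⁶_ℂ`, granted Esnault–Levine–Viehweg's `CH₁ ⊗ ℚ = ℚ`
# (ELV 1997 Thm. 4.6; Laterveer / Voisin II Thm. 10.29–10.31; Voisin 2013 Lemma 2.1; Voisin I §11.3.3)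

Family `hodge`, layer `Literature/AlgebraicGeometry/HodgeTheory`; third file of the seat's series
(`HodgeConjectureProductsOddHypersurfacesSupportedMiddle`: odd-dimensional hypersurfaces with supported middle
cohomology, threefolds of degree `≤ 4` unconditionally; `SupportedClassesOfSmallChowGroups`: small Chow groups force
coniveau), written for the cell `hodge-nonav` (memo ROUTE-P3v20 «SPLIT HYPERSURFACES», THEOREM T6: HC for the cubic
tenfold `{f(x₀..x₅) + g(y₀..y₅) = 0}` ⟸ `HC⁸(Y_f × Y_g)`, whose kernel form `splitCubicTenfoldHCN_of_SK'` has the one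
proving target LEMMA AB at `(m; r, s) = (3; 5, 5)` = `CubicSuspensionPairsHCN`: `HC(F_f × F_g)` for the cubic
fivefolds `F = V(f + u³) ⊂ ℙ⁶`). THEOREMS ONLY (no definition, no NEW named fact; D-0026 net debt `0`); the single
non-proved input is the tree's EXISTING named fact `Motives.EsnaultLevineViehweg1997_chowGroup_rank_le_one`
(hypothesis `hELV`).

THE ARGUMENT. A smooth cubic fivefold `Y ⊂ ℙ⁶_ℂ` has `CH₀(Y)_ℚ = CH₁(Y)_ℚ = ℚ` (Esnault–Levine–Viehweg 1997
Thm. 4.6 with `l = 1`: `C(1 + 3, 2) = 6 ≤ 6`; the tree's named fact, at `m = 5`, `c = 1`, `d = (3)`), hence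
`Motives.ChowRankLEOneUpTo Y 1`, hence `N² H⁵(Y(ℂ); ℂ) = H⁵(Y(ℂ); ℂ)` by the generalised decomposition of the diagonal
(the tree's PROVED `supportedClasses_eq_top_of_chowRankLEOneUpTo`, `k₀ = 1`, `k = 5`) — the classical fact that
the cubic fivefold has Hodge level one (`h^{5,0} = h^{4,1} = 0`, `h^{3,2} = 21`), in support form. Then the seat's
`Motives.IsSmoothHypersurface.hodgeConjectureFor_tensor_hypersurface_of_odd_of_odd_of_supportedClasses_eq_top'`
(`m = n = 5`, `r = s = 2`, `10 ≤ 2(2 + 2 + 1)`) gives `HC(Y × Y')`.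

WHAT IS PROVED (all granted `hELV`, except the bridges).
* `isSmoothCompleteIntersection_of_isHypersurfaceCutOutBy_of_isNonsingularForm` — a smooth projective `n`-fold cut
  out in `ℙ^{n+1}` by a nonsingular form of degree `d ≥ 1` is a smooth complete intersection of multidegree `(d)`
  in the tree's sense (`isNonsingularSystem_const_iff`, `isCutOutBy_const_iff`); `isSmoothHypersurface_of_…` likewise.
* `chowRankLEOneUpTo_one_of_cubicFivefold_of_ELV`, `supportedClasses_five_two_eq_top_of_cubicFivefold_of_ELV`.
* **`hodgeConjectureFor_tensor_cubicFivefolds_of_ELV`** — `HC(Y × Y')` for smooth projective fivefolds cut out in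
  `ℙ⁶_ℂ` by nonsingular septenary cubic forms, granted ELV.

DEVIATIONS / SCOPE. Conditional on the ELV fact (a refereed theorem; its proof — Fano schemes of lines, rational
connectedness — is not in the tree). Hypersurfaces given only as `IsSmoothHypersurface 5 3 Y` (irreducible, possibly
not provably nonsingular defining form on the tree's set-theoretic carrier) are not covered: the nonsingular form is
a hypothesis, as in the cell's binders.

## References
* [EsnaultLevineViehweg1997] H. Esnault, M. Levine, E. Viehweg, Duke Math. J. 87 (1997) — Thm. 4.6 (= Thm. 4.5 of
  the Introduction), first bullet, `l = 1`.
* [VoisinHodgeII2003] C. Voisin, *Hodge Theory and Complex Algebraic Geometry II* — Thm. 10.29, Thm. 10.31;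
  §1.2.3 Cor. 1.24–1.25.
* [Voisin2013GHCBloch] C. Voisin, Ann. Sci. ÉNS 46 (2013) — Lemma 2.1 (proof).
* [VoisinHodgeI2002] C. Voisin, *Hodge Theory and Complex Algebraic Geometry I* — §11.3.3 Thm. 11.38, Lemma 11.41.
* [Hartshorne1977] R. Hartshorne, *Algebraic Geometry* — II Example 8.20.2.

## Provenance
Cell `hodge-nonav` (summit `HodgeConjecture`, rung F-H1), seat `littype-FH1-2` (literature-prover, generation 17).
-/

noncomputable section

open CategoryTheory AlgebraicGeometry MonoidalCategory MvPolynomial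
open Literature.AlgebraicTopology.SingularHomology

namespace Literature.AlgebraicGeometry.HodgeTheory

open Literature.AlgebraicGeometry.Motives Literature.AlgebraicGeometry.Motives.SmoothHypersurface

variable {n d : ℕ} {X X' : SchemeOver ℂ}

/-! ### Bridges from «cut out by a nonsingular form» -/

/-- **A smooth projective `n`-fold cut out set-theoretically in `ℙ^{n+1}_ℂ` by a NONSINGULAR form of degree `d ≥ 1`
is a smooth complete intersection of multidegree `(d)`** in the tree's sense (`Motives.IsSmoothCompleteIntersection`:
one homogeneous form, Jacobian condition `isNonsingularSystem_const_iff`, set-theoretic cut-out `isCutOutBy_const_iff`).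
[cite: Hartshorne1977, II Example 8.20.2 and I Ex. 5.8] -/
theorem isSmoothCompleteIntersection_of_isHypersurfaceCutOutBy_of_isNonsingularForm (hX : IsSmoothProjective n X)
    {F : MvPolynomial (Fin (n + 2)) ℂ} (hF : F.IsHomogeneous d) (hd : 0 < d) (hJ : IsNonsingularForm ℂ F)
    (hcut : IsHypersurfaceCutOutBy (n + 1) F X) : IsSmoothCompleteIntersection n (fun _ : Fin 1 => d) X :=
  ⟨hX, fun _ => F, fun _ => hF, fun _ => hd, (isNonsingularSystem_const_iff F).2 hJ, (isCutOutBy_const_iff F X).2 hcut⟩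

/-- The same data give a smooth hypersurface of degree `d` in the sense of `Motives.IsSmoothHypersurface` (`n ≥ 1`: a
nonsingular form in `≥ 3` variables is irreducible). [cite: Hartshorne1977, II Example 8.20.2] -/
theorem isSmoothHypersurface_of_isHypersurfaceCutOutBy_of_isNonsingularForm' (hn : 1 ≤ n) (hX : IsSmoothProjective n X)
    {F : MvPolynomial (Fin (n + 2)) ℂ} (hF : F.IsHomogeneous d) (hd : 0 < d) (hJ : IsNonsingularForm ℂ F)
    (hcut : IsHypersurfaceCutOutBy (n + 1) F X) : IsSmoothHypersurface n d X :=
  ⟨hX, F, hF, hJ.irreducible hn hd hF, hcut⟩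

/-! ### Cubic fivefolds: `CH₀, CH₁` (ELV) ⟹ `N² H⁵ = H⁵` -/

/-- **`CH₀(Y)_ℚ` and `CH₁(Y)_ℚ` have rank `≤ 1` for a smooth cubic fivefold**, granted Esnault–Levine–Viehweg
(`l = 1`: `C(4, 2) = 6 ≤ 5 + 1`). [cite: EsnaultLevineViehweg1997, Thm 4.6 (announced as Thm 4.5 in the Introduction), first bullet] -/
theorem chowRankLEOneUpTo_one_of_cubicFivefold_of_ELV (hELV : EsnaultLevineViehweg1997_chowGroup_rank_le_one.{0})
    (hX : IsSmoothCompleteIntersection 5 (fun _ : Fin 1 => 3) X) : ChowRankLEOneUpTo X 1 :=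
  (chowRankLEOneUpTo_iff_chowGroup X 1).2 fun _ hj a b =>
    hELV hX (fun _ => by norm_num) (l := 1) (Or.inl ⟨0, le_rfl⟩) (by simp [Nat.choose]) hj a b

/-- **The middle cohomology of a smooth cubic fivefold is supported in codimension `2`: `N² H⁵(Y(ℂ); ℂ) = H⁵(Y(ℂ); ℂ)`**,
granted ELV (small `CH₀, CH₁` + generalised decomposition of the diagonal, `supportedClasses_eq_top_of_chowRankLEOneUpTo`).
[cite: EsnaultLevineViehweg1997, Thm 4.6 (announced as Thm 4.5 in the Introduction), first bullet]
[cite: VoisinHodgeII2003, Thm. 10.29 and proof of Thm. 10.31] -/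
theorem supportedClasses_five_two_eq_top_of_cubicFivefold_of_ELV
    (hELV : EsnaultLevineViehweg1997_chowGroup_rank_le_one.{0})
    (hX : IsSmoothCompleteIntersection 5 (fun _ : Fin 1 => 3) X) : supportedClasses X 5 2 = ⊤ :=
  supportedClasses_five_two_eq_top_of_chowRankLEOneUpTo_one hX.1 (chowRankLEOneUpTo_one_of_cubicFivefold_of_ELV hELV hX)

/-! ### `HC(Y × Y')` for cubic fivefolds, granted ELV -/

/-- **`HC(Y × Y')` for two smooth projective fivefolds cut out in `ℙ⁶_ℂ` by NONSINGULAR cubic forms, granted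
Esnault–Levine–Viehweg** (`N²H⁵ = H⁵` on both factors; the seat's product theorem for odd-dimensional hypersurfaces
with supported middle cohomology, `m = n = 5`, `r = s = 2`). [cite: EsnaultLevineViehweg1997, Thm 4.6 (announced as Thm 4.5 in the Introduction), first bullet]
[cite: Voisin2013GHCBloch, Lemma 2.1 (proof)] [cite: VoisinHodgeI2002, §11.3.3 Thm. 11.38, Lemma 11.41 and p. 287]
[cite: VoisinHodgeII2003, §1.2.3 Cor. 1.24–1.25 and Thm. 10.31] -/
theorem hodgeConjectureFor_tensor_cubicFivefolds_of_ELV (hELV : EsnaultLevineViehweg1997_chowGroup_rank_le_one.{0})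
    {F G : MvPolynomial (Fin (5 + 2)) ℂ} (hF : F.IsHomogeneous 3) (hG : G.IsHomogeneous 3)
    (hJF : IsNonsingularForm ℂ F) (hJG : IsNonsingularForm ℂ G) (hX : IsSmoothProjective 5 X)
    (hcutX : IsHypersurfaceCutOutBy (5 + 1) F X) (hX' : IsSmoothProjective 5 X')
    (hcutX' : IsHypersurfaceCutOutBy (5 + 1) G X') : HodgeConjectureFor (5 + 5) (X ⊗ X') :=
  (isSmoothHypersurface_of_isHypersurfaceCutOutBy_of_isNonsingularForm' (by norm_num) hX hF (by norm_num) hJF hcutX)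
    |>.hodgeConjectureFor_tensor_hypersurface_of_odd_of_odd_of_supportedClasses_eq_top'
      (isSmoothHypersurface_of_isHypersurfaceCutOutBy_of_isNonsingularForm' (by norm_num) hX' hG (by norm_num) hJG hcutX')
      (by decide) (by decide) (r := 2) (s := 2) (by norm_num)
      (supportedClasses_five_two_eq_top_of_cubicFivefold_of_ELV hELV
        (isSmoothCompleteIntersection_of_isHypersurfaceCutOutBy_of_isNonsingularForm hX hF (by norm_num) hJF hcutX))
      (supportedClasses_five_two_eq_top_of_cubicFivefold_of_ELV hELV
        (isSmoothCompleteIntersection_of_isHypersurfaceCutOutBy_of_isNonsingularForm hX' hG (by norm_num) hJG hcutX'))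

end Literature.AlgebraicGeometry.HodgeTheory

end
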